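import Summits.AnomalousDissipation.AnomalousDissipation.Theorems.SolenoidalFractalHomogenisationLagrangianStepDatumTail
import Literature.Analysis.FunctionSpaces.TorusTruncationH1
import Literature.Analysis.FunctionSpaces.TorusFourierModes
import Literature.Analysis.FunctionSpaces.TorusFluidGlueProofs
import HarnessLib

/-!
# K1L_D · the TRIMMED datum `P_{≤L} w₀` is again an admissible class-`R` datum (F-lead-5 bookkeeping for the v3 cut)

Proof-support file (all proofs, 0 defs) for the crux `LagrangianRenormalisationStepDesign` (stmt-AnomalousDissipation-27980), amended
v3 cut of `stub_oneLevelL_IW` (tenure D24-11; lead `lead-k1l-onelevel-p1` F-lead-5 / spec (P1) 16:52:50Z): the composition runs the window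
ledger on the band-limited datum `w₁ := Torus.fourierTruncate L w₀` and owes that `w₁` is again `IsDatum` (here), `InClass R`
(`…ClassTruncate`) and band limited (here):

* `isDatum_fourierTruncate` — `IsDatum w₀ → IsDatum (fourierTruncate L w₀)` (trig polynomials are `H¹`; the zero mode and weak
  divergence-freeness survive truncation);
* (`InClass R` is stable under truncation: `inClass_fourierTruncate` of `…LagrangianStepClassTruncate`, p650759 — not repeated here);
* `fourierTruncate_fourierTruncate` — `fourierTruncate L (fourierTruncate L w₀) = fourierTruncate L w₀` (band-limited: `cutLp`-idempotence).
-/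

set_option linter.dupNamespace false

namespace Summit.AnomalousDissipation.AnomalousDissipation.Theorems.SolenoidalFractalHomogenisation.LagrangianStep

open Literature.Analysis Literature.Analysis.FluidPDE Literature.Analysis.FunctionSpaces
open Literature.Analysis.FluidPDE.LatticeShear
open MeasureTheory Set Filter Function UnitAddTorus
open scoped ENNReal NNReal InnerProductSpace Topology
open Summit.AnomalousDissipation.AnomalousDissipation.Theorems.SolenoidalFractalHomogenisation.RealisedQuasiStaticCellLaw

noncomputable section

/-- An admissible datum is in `L²`. [folklore] -/
theorem IsDatum.memLp_two {w₀ : VF} (hw : IsDatum w₀) : MemLp w₀ 2 volume :=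
  memLp_two_of_memSobolev_one_complexify hw.1

/-- **The truncation of an admissible datum is band limited**: its Fourier coefficients vanish off the ball `|k| ≤ L`. [folklore] -/
theorem mFourierCoeff_fourierTruncate_eq_zero {w₀ : VF} (hw : Integrable w₀ volume) (L : ℕ) {k : Fin 3 → ℤ}
    (hk : (L : ℝ) ^ 2 < Torus.freqNormSq k) :
    mFourierCoeff (FunctionSpaces.EuclideanSpace.complexify ∘ Torus.fourierTruncate L w₀) k = 0 := by
  rw [Torus.mFourierCoeff_fourierTruncate hw, if_neg (Torus.not_mem_freqBall.2 hk)]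

/-- **`P_{≤L}` is idempotent** (the truncated datum is band limited, `cutLp`-form `fourierTruncate L w₁ = w₁`). [folklore] -/
theorem fourierTruncate_fourierTruncate {w₀ : VF} (hw : Integrable w₀ volume) (L : ℕ) :
    Torus.fourierTruncate L (Torus.fourierTruncate L w₀) = Torus.fourierTruncate L w₀ :=
  Torus.fourierTruncate_eq_self (Torus.continuous_fourierTruncate L w₀) fun _ hk => mFourierCoeff_fourierTruncate_eq_zero hw L hk

/-- **The truncated datum is an admissible datum**: `H¹` (a trigonometric polynomial is smooth), mean zero (the zero mode is kept/unchanged),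
weakly divergence free (`isDivFree_fourierTruncate` + smooth ⇒ weak). [folklore] -/
theorem isDatum_fourierTruncate {w₀ : VF} (hw : IsDatum w₀) (L : ℕ) : IsDatum (Torus.fourierTruncate L w₀) := by
  have h2 : MemLp w₀ 2 volume := hw.memLp_two
  have hi : Integrable w₀ volume := h2.integrable one_le_two
  refine ⟨(Torus.isSmooth_fourierTruncate L w₀).memSobolev_one_complexify, Torus.hasZeroMean_fourierTruncate hi hw.2.1 L, ?_⟩
  exact Torus.IsDivFree.isWeaklyDivFree Torus.integral_inner_gradient_eq_neg_integral_mul_divergence_holds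
    (Torus.isSmooth_fourierTruncate L w₀) (Torus.isDivFree_fourierTruncate h2 hw.2.2 L)

-- `inClass_fourierTruncate` (truncation lowers the Rayleigh quotient) is ALREADY in the tree: `…LagrangianStepClassTruncate` (p650759, lead g2).

end

end Summit.AnomalousDissipation.AnomalousDissipation.Theorems.SolenoidalFractalHomogenisation.LagrangianStep
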